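import Mathlib
import Summits.BirchSwinnertonDyer.BirchSwinnertonDyer.Theorems.Rank2ObservatoryIsoTable
import Summits.BirchSwinnertonDyer.BirchSwinnertonDyer.Theorems.Rank2ObservatoryRank3RootNumber3Census
import HarnessLib

/-!
# Rank ≥ 2 observatory — KERNEL-ISO table instrument in rank `r` (rank-3 arm): `IsoRow.checkRank`

HONEST FRAMING: per-curve certified theorems and census instruments; no claim on BSD in rank ≥ 2.

The KERNEL-ISO table instrument (`Rank2ObservatoryIsoTable.lean`: the record schema `IsoRow` of a
descent-via-`2`-isogeny certificate — integral point data, class lists with product structure, non-residue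
moduli, Selmer supersets with kill certificates — and the rank-`2` row check `IsoRow.check`) is made
RANK-PARAMETRIC: `IsoRow.checkRank R r` is the same Boolean with `log₂ #D₁ + log₂ #D₂ ≤ r + 2` and
`2^(r+1) < #cls₁ · #cls₂`, and `IsoRow.mordellWeilRank_eq_of_checkRank : R.checkRank r = true →
rank_ℤ R.curve(ℚ) = r` is the same soundness argument (`sideCheck_sound`, the Selmer upper bound
`mordellWeilRank_le_of_selmer_subsets`, the class lower bound `le_mordellWeilRank_of_classes`, and the transport
`exists_transport` to the census model). `IsoRow.check3 := checkRank · 3` is the shape used by the rank-3 data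
chunks `Rank2ObservatoryRank3IsoRowsNNN.lean` (the 966 curves of the rank-3 census `rank3Table` with exactly one
rational point of order `2`; all of them have the sharp bound `#S^(φ)·#S^(φ̂) = 2⁵`). Sanity: `checkRank R 2 = R.check`
definitionally.

The second half is the JOIN with the rank-3 CENSUS `rank3Table`, in the shape of the rank-2 JOIN of
`Rank2ObservatoryIsoTable.lean` but on the integer MODEL key (a-invariants; `IsoRow.aKey`, `aKey₃`):
`curve_eq_of_aKey_eq`, `census₃_rank_of_aKey_mem` (a census row whose model occurs among checked rows has rank `3`),
the provenance test `curve_mem_of_isSublist₃` (ONE kernel `decide` of `List.isSublist` over `rank3Table` certifies that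
every listed model is a census model), and the census-row form `census₃_analyticRank_eq_rank` (`r_an = rank_ℤ = 3`
via `Rank3Row.analyticRank_eq_rank_kernel_w`, under the named analytic hypotheses only).

## References
* J. H. Silverman, J. Tate, *Rational Points on Elliptic Curves*, 2nd ed. (2015), §3.6. [cite: SilvermanTate2015, §3.6]
* J. E. Cremona, *Algorithms for Modular Elliptic Curves*, 2nd ed. (1997), §3.6 (Method 1), Tables.
  [cite: CremonaAlgorithms1997, §3.6 (Method 1)]
* J. H. Silverman, *The Arithmetic of Elliptic Curves*, 2nd ed. (2009), III.3.1(b). [cite: SilvermanAEC2009, III.3.1(b)]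
-/

-- single-conjunct summit: `Summit.BirchSwinnertonDyer.BirchSwinnertonDyer.…` repeats the name by design
set_option linter.dupNamespace false

namespace Summit.BirchSwinnertonDyer.BirchSwinnertonDyer.Rank2Observatory

open WeierstrassCurve Literature Literature.NumberTheory.EllipticCurves
open WeierstrassCurve.Affine (sqClass)
open Literature.Barriers.BirchSwinnertonDyer.DokchitserDokchitser2011 RootNumber

namespace IsoLocal

namespace IsoRow

/-- **The rank-`r` row check** (kernel-decidable): cert-3's `IsoRow.check` with the two numerical bounds
read at rank `r` (`log₂ #D₁ + log₂ #D₂ ≤ r + 2`, `2^(r+1) < #cls₁ · #cls₂`). [cite: SilvermanTate2015, §3.6] -/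
def checkRank (R : IsoRow) (r : ℕ) : Bool :=
  (R.scaled || (R.a₁ == 0 && R.a₃ == 0)) &&
  (R.e ^ 3 + R.A.1 * R.e ^ 2 + R.A.2.1 * R.e + R.A.2.2 == 0) &&
  (R.ab.2 * (R.ab.1 ^ 2 - 4 * R.ab.2) != 0) &&
  sideCheck R.ab.1 R.ab.2 R.s₁ && sideCheck (-2 * R.ab.1) (R.ab.1 ^ 2 - 4 * R.ab.2) R.s₂ &&
  decide (Nat.log 2 R.s₁.D.dedup.length + Nat.log 2 R.s₂.D.dedup.length ≤ r + 2) &&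
  decide (2 ^ (r + 1) < R.s₁.cls.length * R.s₂.cls.length)

/-- At `r = 2` the rank-parametric check IS cert-3's row check (definitionally). [folklore] -/
theorem checkRank_two (R : IsoRow) : R.checkRank 2 = R.check := rfl

/-- The rank-`3` row check (the shape of the rank-3 data chunks' kernel theorems). [folklore] -/
def check3 (R : IsoRow) : Bool := R.checkRank 3

/-- **KERNEL-ISO table theorem in rank `r`: `R.checkRank r = true ⇒ rank_ℤ E(ℚ) = r`** for the row's
census model, unconditionally (the proof of `IsoRow.mordellWeilRank_eq_two` with `r` for `2`).
[cite: SilvermanTate2015, §3.6] [cite: CremonaAlgorithms1997, §3.6 (Method 1)] -/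
theorem mordellWeilRank_eq_of_checkRank (R : IsoRow) {r : ℕ} (h : R.checkRank r = true) :
    R.curve.mordellWeilRank = r := by
  simp only [checkRank, Bool.and_eq_true, Bool.or_eq_true, beq_iff_eq, bne_iff_ne, ne_eq,
    decide_eq_true_eq] at h
  obtain ⟨⟨⟨⟨⟨⟨hsc, he⟩, hab⟩, h₁⟩, h₂⟩, hcard⟩, hlen⟩ := h
  obtain ⟨hD₁, hk₁⟩ := sideCheck_sound hab h₁
  obtain ⟨hD₂, hk₂⟩ := sideCheck_sound (twoIsogenyCodomain_ne_zero hab) h₂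
  have hE₁ : (⟨0, (R.ab.1 : ℚ), 0, (R.ab.2 : ℚ), 0⟩ : WeierstrassCurve ℚ).mordellWeilRank = r := by
    refine le_antisymm ?_ ?_
    · refine mordellWeilRank_le_of_selmer_subsets hab hD₁ hD₂ ?_
      rwa [List.card_toFinset, List.card_toFinset]
    · exact le_mordellWeilRank_of_classes hab hk₁ (by rw [twoIsogenyCodomain_mk_intCast]; exact hk₂) hlen
  obtain ⟨C, hC⟩ := exists_transport R hsc he
  have ht := mordellWeilRank_variableChange_holds R.curve C
  rw [mordellWeilRank_variableChange, hC] at ht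
  rw [← ht]
  exact hE₁

/-- Rank-`3` row theorem. [cite: SilvermanTate2015, §3.6] -/
theorem mordellWeilRank_eq_three (R : IsoRow) (h : R.check3 = true) : R.curve.mordellWeilRank = 3 :=
  R.mordellWeilRank_eq_of_checkRank h

/-- Chunk form over `List.all` (the shape of the rank-3 data chunks' kernel theorems). [cite: SilvermanTate2015, §3.6] -/
theorem mordellWeilRank_eq_three_of_all {rows : List IsoRow} (h : rows.all IsoRow.check3 = true)
    {R : IsoRow} (hR : R ∈ rows) : R.curve.mordellWeilRank = 3 :=
  R.mordellWeilRank_eq_three (List.all_eq_true.mp h R hR)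

/-- The MODEL key of a KERNEL-ISO row: its a-invariants (the rank-2 JOIN key `IsoRow.key` minus the label, so that
the kernel JOIN below compares integers only). [cite: CremonaAlgorithms1997, Tables] -/
def aKey (R : IsoRow) : ℤ × ℤ × ℤ × ℤ × ℤ := (R.a₁, R.a₂, R.a₃, R.a₄, R.a₆)

end IsoRow

/-! ### JOIN with the rank-3 census (`rank3Table`)

Same shape as the rank-2 JOIN of `Rank2ObservatoryIsoTable.lean` (`censusKey`, `curve_eq_of_key_eq`,
`census_rank_of_key_mem`, `key_mem_of_isSublist`), for `Rank3Row` and the integer model key `IsoRow.aKey`. -/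

/-- The MODEL key of a rank-3 census row (`Rank2ObservatoryRank3Table.lean`): its a-invariants.
[cite: CremonaAlgorithms1997, Tables] -/
def aKey₃ (r : Rank3Row) : ℤ × ℤ × ℤ × ℤ × ℤ := (r.a₁, r.a₂, r.a₃, r.a₄, r.a₆)

/-- Equal model keys ⇒ equal models. [cite: CremonaAlgorithms1997, Tables] -/
theorem curve_eq_of_aKey_eq {R : IsoRow} {r : Rank3Row} (h : R.aKey = aKey₃ r) : r.curve = R.curve := by
  simp only [IsoRow.aKey, aKey₃, Prod.mk.injEq] at h
  obtain ⟨h₁, h₂, h₃, h₄, h₆⟩ := h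
  simp only [Rank3Row.curve, IsoRow.curve, h₁, h₂, h₃, h₄, h₆]

/-- JOIN, census direction: a rank-3 census row whose model key occurs among `check3`-ed KERNEL-ISO rows has
Mordell–Weil rank exactly `3` (unconditional). [cite: SilvermanTate2015, §3.6] [cite: CremonaAlgorithms1997, Tables] -/
theorem census₃_rank_of_aKey_mem {rows : List IsoRow} (hc : rows.all IsoRow.check3 = true) {r : Rank3Row}
    (h : aKey₃ r ∈ rows.map IsoRow.aKey) : r.curve.mordellWeilRank = 3 := by
  obtain ⟨R, hR, hk⟩ := List.mem_map.mp h
  rw [curve_eq_of_aKey_eq hk]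
  exact IsoRow.mordellWeilRank_eq_three_of_all hc hR

/-- JOIN, provenance direction: if the model keys of `rows` form a sublist of the model keys of the census rows
`tab` (decidable, `List.isSublist`: ONE linear kernel walk), then every KERNEL-ISO row's model IS a census model.
[cite: CremonaAlgorithms1997, Tables] -/
theorem curve_mem_of_isSublist₃ {rows : List IsoRow} {tab : List Rank3Row}
    (h : ((rows.map IsoRow.aKey).isSublist (tab.map aKey₃)) = true) :
    ∀ R ∈ rows, ∃ r ∈ tab, r.curve = R.curve := by
  have hs := List.isSublist_iff_sublist.mp h
  intro R hR
  have hm : R.aKey ∈ tab.map aKey₃ := hs.subset (List.mem_map.mpr ⟨R, hR, rfl⟩)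
  obtain ⟨r, hr, hk⟩ := List.mem_map.mp hm
  exact ⟨r, hr, curve_eq_of_aKey_eq hk.symm⟩

/-- **Census-row form `r_an = rank_ℤ = 3`** along the JOIN, for a row OF `rank3Table`: the rank is unconditional
(`hlow`, `hup` discharged by the kernel certificate), `w = −1` comes from the kernel-certified local root numbers
(`Rank3Row.analyticRank_eq_rank_kernel_w`); remaining hypotheses: Gross–Zagier–Kolyvagin in analytic rank `≤ 1`,
the numerical input `L‴(E,1) ≠ 0`, and the two named root-number facts.
[cite: Darmon2004, Thm. 3.22] [cite: CremonaAlgorithms1997, §2.13] -/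
theorem census₃_analyticRank_eq_rank {rows : List IsoRow} (hc : rows.all IsoRow.check3 = true)
    {r : Rank3Row} (hr : r ∈ rank3Table) (h : aKey₃ r ∈ rows.map IsoRow.aKey)
    (hGZK : rank_eq_analyticRank_of_analyticRank_le_one)
    (hL3 : iteratedDeriv 3 r.curve.entireLFunction 1 ≠ 0)
    (hKD : r.curve.rootNumber_eq_neg_finprod_tableLocalRootNumberAt')
    (hR : r.curve.rootNumber_eq_neg_finprod_fullTableLocalRootNumberAt) :
    r.curve.analyticRank = r.curve.mordellWeilRank ∧ r.curve.analyticRank = 3 := by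
  have h3 := census₃_rank_of_aKey_mem hc h
  have h' := Rank3Row.analyticRank_eq_rank_kernel_w hr hGZK h3.le hL3 hKD hR
  exact ⟨h', h'.trans h3⟩

/-! ### Sanity checks of the decidable side -/

/-- `check3` on the all-empty row is `false` (no classes, no points). [folklore] -/
example : (⟨"y", 0, 1, 0, 3, 4, 0, false, ⟨[], [], [], [], [], [], []⟩, ⟨[], [], [], [], [], [], []⟩⟩ : IsoRow).check3
    = false := by decide

/-- The JOIN test on a toy pair of lists. [folklore] -/
example : (([(⟨"y", 0, 1, 0, 3, 4, 0, false, ⟨[], [], [], [], [], [], []⟩, ⟨[], [], [], [], [], [], []⟩⟩ : IsoRow)].map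
      IsoRow.aKey).isSublist
    ([(⟨"x", 0, 0, 0, 1, 2, 11, -7, 2, (0, 1, 0), (0, 1, 0), (0, 1, 0)⟩ : Rank3Row),
      ⟨"y", 0, 1, 0, 3, 4, 11, -7, 2, (0, 1, 0), (0, 1, 0), (0, 1, 0)⟩].map aKey₃)) = true := by
  decide

end IsoLocal

end Summit.BirchSwinnertonDyer.BirchSwinnertonDyer.Rank2Observatory
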